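import Summits.ResolutionOfSingularities.ResolutionOfSingularities.Theorems.TightCutCharts2
import HarnessLib

/-!
# TightCutPoverty — decomp-res node «TightCut» (lens-3 g17), tree file 5/7: §P **THE SHADE-THREE WINDOW IS
EMPTY for `q ≥ 7`** — the POVERTY
LEDGER (`TailThree`, poor stages, (P1)–(P4): `repeat_into_zero_false`, `hasZero_succ`, `repeat_false`) and
`TailThree.shadeThree_tail_false`.
PROVED, 0 sorry.

Content VERBATIM from the decomp-res lens-3 g17 file `HOME/decomp-res-lens-3/g17/TightCut.lean` (sha256
7fe2fb69bd2eaf82, 3149 l;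
HOME = run/shared/lean/pub/decomp-res).  Critic: CRITIC-LEDGER row 136 CLEARED, landing order 2026-08-30T19:49:35Z
(after node «ShadeCut» =
`Theorems/ShadeCutLawJ`, `ShadeCutTailTwo`, `ShadeCutShadeTwo`, `MaxContactCutShadeCut`).

[WRITER NOTE (decomp-res writer g7): the lens's carried VERBATIM copies §V1/§V2 (g15 ConeCut calculus),
§J/§S/§K/§L/§M (g16 ShadeCut) are
DELETED in favour of the landed `Theorems/ConeCut*`, `ConeCutAxisLaw`, `FloorCutFloor`, `ShadeCut*`,
`MaxContactCutShadeCut` (imported and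
opened; `exists_third`/`exists_ne` now the tree's `ConeCut.exists_third` / `FloorCut.exists_ne`); the by-name
`closes` re-export (§M) is not
restated; g16's `fin3_enum` (dedup of a Literature triviality) becomes a proof-local `have … := by decide` in `prod_three`.  NEW content only, split by the lens's own sections (400-line file limit): `TightCutLawJ2` (§J₂.1–§J₂.3), `TightCutWitness`
(§J₂.4–§J₂.5), `TightCutCharts` + `TightCutCharts2` (§J₂.6), `TightCutPoverty` (§P), `TightCutClasses`
(cone-free: the two §K3 classes, home of
the aside), `MaxContactCutTightCut` (Theses cone: §K3 theorems + §L4 + §N).  ONE namespace `…Theorems.TightCut`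
as in the lens; global
`set_option` line dropped; nothing else changed.]
(Sources: CossartPiltant2008 Prop. 4.2; CossartPiltant2009; CossartJannsenSaito2020; Hauser2010; Moh1987;
HauserPerlega2019; BenitoVillamayor2012; Cutkosky2009 Thm. 5.1.)
-/

noncomputable section

open MvPolynomial Finset
open Literature.AlgebraicGeometry.Resolution
open Literature.AlgebraicGeometry.Resolution.Hauser2010
open Literature.AlgebraicGeometry.Resolution.PointBlowup
open Summit.ResolutionOfSingularities.ResolutionOfSingularities.Theses
open Summit.ResolutionOfSingularities.ResolutionOfSingularities.Theorems.TightDefectClasses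
open Summit.ResolutionOfSingularities.ResolutionOfSingularities.Theorems.TightDefectStrongWalks
open Summit.ResolutionOfSingularities.ResolutionOfSingularities.Theorems.ItineraryCutClasses
open Summit.ResolutionOfSingularities.ResolutionOfSingularities.Theorems.BoundaryLedger
open Summit.ResolutionOfSingularities.ResolutionOfSingularities.Theorems.ProximityCut
open Summit.ResolutionOfSingularities.ResolutionOfSingularities.Theorems.ConeCutAxisLaw
open Literature.AlgebraicGeometry.Resolution.WeightedBlowup
open Literature.Barriers.ResolutionOfSingularities
open Summit.ResolutionOfSingularities.ResolutionOfSingularities.Theorems.FloorCut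
open Summit.ResolutionOfSingularities.ResolutionOfSingularities.Theorems.ConeCut
open Summit.ResolutionOfSingularities.ResolutionOfSingularities.Theorems.ExitLaw (fin3_cases)
open Summit.ResolutionOfSingularities.ResolutionOfSingularities.Theorems.ShadeCut

namespace Summit.ResolutionOfSingularities.ResolutionOfSingularities.Theorems.TightCut

/-! ## §P  THE SHADE-THREE WINDOW IS EMPTY for `q ≥ 7` (new, g17): the POVERTY LEDGER

Write `D_t = |r_t|`; on a shade-3 tail `o_t = D_t + 3`, `q < o_t < 2q`, the newest mass is `r_{t+1}(j_t) =
D_t + 3 − q ≥ 1`.  Call stage `t` POOR if `r_t` has a zero coordinate; then `D_t ≤ q − 1` (two coordinates sum to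
`< q`, the axis law).  (P2) a translated move makes the next stage poor; (P3) poverty PROPAGATES along the tail —
the only move that could destroy it, an untranslated chart change INTO the zero coordinate, is an untranslated
proximity repeat with `D_{t+1} ≥ q − 2` (order window two moves on), so by LAW J it is TIGHT, and by LAW J₂ the
next move re-blows that chart translated along both other axes, leaving `D = 2`, `o = 5 ≤ q`: absurd; (P4) two
consecutive poor stages admit no proximity repeat (`D ≤ 4` two moves on, or (P3)'s contradiction).  Hence after
the first translation of the tail no repeat ever happens again — against the recurrence hypothesis. -/

section Poverty

variable {K : Type} [Field K] [DecidableEq K] {q : ℕ} {s₀ : State (Fin 3) K}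

/-- The hypotheses of the SHADE-THREE WINDOW from stage `N`, bundled: plateau, shade `3`, positive excess.
DEFINITION (support). -/
structure TailThree (W : ForcedWalk q s₀) (N : ℕ) : Prop where
  plat : ∀ t, N ≤ t → (W.st (t + 1)).shade = (W.st t).shade
  three : (W.st N).shade = ((3 : ℕ) : ℕ∞)
  ex : ∀ t, N ≤ t → ordZero (W.st t).F ≠ ((q : ℕ) : ℕ∞)

/-- (P1) a poor boundary has mass `< q` (axis law on the other two coordinates). [folklore] -/
theorem degree_lt_of_hasZero (hroot : IsRoot q s₀) (W : ForcedWalk q s₀) (t : ℕ) (hz : HasZero W t) :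
    (W.st t).r.degree < q := by
  obtain ⟨l, hl⟩ := hz
  obtain ⟨a, ha⟩ := FloorCut.exists_ne l
  obtain ⟨c, hca, hcl⟩ := exists_third ha
  rw [degree_eq_three (W.st t).r ha hca hcl]
  have := pair_lt hroot W t hca
  omega

/-- (P2) a translated move zeroes the translated coordinate of the next boundary. [folklore] -/
theorem hasZero_of_translated (W : ForcedWalk q s₀) (t : ℕ) {o : ℕ} (ho : ordZero (W.st t).F = o)
    (hb : W.b t ≠ 0) : HasZero W (t + 1) := by
  have hex : ∃ m, W.b t m ≠ 0 := by
    by_contra hall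
    push Not at hall
    exact hb (funext hall)
  obtain ⟨m, hm⟩ := hex
  have hmj : m ≠ W.j t := fun h => hm (by rw [h]; exact W.onExc t)
  refine ⟨m, ?_⟩
  rw [r_succ_eq W t ho, Finsupp.add_apply, Finsupp.single_eq_of_ne hmj, add_zero, kept_apply, if_neg]
  exact fun h => hm h.2

namespace TailThree

variable {W : ForcedWalk q s₀} {N : ℕ}

/-- `shade_eq`: Auxiliary step of this node's calculus, VERBATIM from the lens file (see the module docstring); the
statement is its type. [folklore] -/
theorem shade_eq (h : TailThree W N) : ∀ t, N ≤ t → (W.st t).shade = ((3 : ℕ) : ℕ∞) :=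
  shade_of_plateau W h.plat h.three

/-- The order window `q < o_t = D_t + 3 < 2q` on the tail. [folklore] -/
theorem order (hroot : IsRoot q s₀) (h : TailThree W N) (t : ℕ) (ht : N ≤ t) :
    ∃ o : ℕ, ordZero (W.st t).F = o ∧ q < o ∧ o < 2 * q ∧ o = 3 + (W.st t).r.degree := by
  obtain ⟨o, ho, hqo, ho2⟩ := NoJump.order_lt_two_mul hroot W t
  have hne : o ≠ q := by
    intro hoq
    exact h.ex t ht (by rw [ho, hoq])
  exact ⟨o, ho, by omega, ho2, order_eq_of_plateau hroot W ho (h.shade_eq t ht)⟩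

/-- THE LEDGER of a tail move: `D_{t+1} + q = |kept_t| + D_t + 3`, newest mass `D_t + 3 − q`, off-chart
coordinates kept. [folklore] -/
theorem step (hroot : IsRoot q s₀) (h : TailThree W N) (t : ℕ) (ht : N ≤ t) :
    (W.st (t + 1)).r.degree + q = (kept W t).degree + (W.st t).r.degree + 3 ∧
    (W.st (t + 1)).r (W.j t) + q = (W.st t).r.degree + 3 ∧
    ∀ i, i ≠ W.j t → (W.st (t + 1)).r i = kept W t i := by
  obtain ⟨o, ho, hqo, -, hod⟩ := h.order hroot t ht
  have hdeg := degree_r_succ W t ho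
  have hch := NoJump.r_succ_chart W t ho
  refine ⟨by omega, by omega, fun i hi => ?_⟩
  rw [r_succ_eq W t ho, Finsupp.add_apply, Finsupp.single_eq_of_ne hi, add_zero]

/-- `degree_window`: Auxiliary step of this node's calculus, VERBATIM from the lens file (see the module docstring);
the statement is its type. [folklore] -/
theorem degree_window (hroot : IsRoot q s₀) (h : TailThree W N) (t : ℕ) (ht : N ≤ t) :
    q ≤ (W.st t).r.degree + 2 ∧ (W.st t).r.degree + 4 ≤ 2 * q := by
  obtain ⟨o, -, hqo, ho2, hod⟩ := h.order hroot t ht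
  omega

/-- The kept mass along the three named coordinates. [folklore] -/
theorem kept_three (W : ForcedWalk q s₀) (u : ℕ) {m : Fin 3} (hcn : W.j (u + 1) ≠ W.j u) (hmn : m ≠ W.j u)
    (hmc : m ≠ W.j (u + 1)) (hbn : W.b (u + 1) (W.j u) = 0) :
    (kept W (u + 1)).degree = (W.st (u + 1)).r (W.j u) + kept W (u + 1) m ∧
      kept W (u + 1) m = (if W.b (u + 1) m = 0 then (W.st (u + 1)).r m else 0) := by
  have hkn : kept W (u + 1) (W.j u) = (W.st (u + 1)).r (W.j u) := by
    rw [kept_of_ne W (u + 1) hcn.symm, if_pos hbn]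
  have hkc := kept_chart W (u + 1)
  refine ⟨?_, kept_of_ne W (u + 1) hmc⟩
  rw [degree_eq_three (kept W (u + 1)) hcn.symm hmn hmc]
  omega

/-- **(P3⁰) A REPEAT INTO A ZERO COORDINATE IS IMPOSSIBLE** (`q ≥ 5`).  An untranslated chart change at move
`u+1` into a coordinate `l` with `r_{u+1}(l) = 0` keeps all of `D_{u+1}`, so `D_{u+2} = 2 D_{u+1} + 3 − q ≥ q − 2`
forces `D_{u+1} ≥ q − 2`; LAW J gives `≤ q − 2`: the repeat is TIGHT, LAW J₂ makes move `u+2` re-blow `u_l`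
translated along both other axes, `D_{u+3} = 2`, `o_{u+3} = 5 ≤ q`. [new] [folklore] -/
theorem repeat_into_zero_false (hroot : IsRoot q s₀) (hq : 7 ≤ q) (h : TailThree W N) (u : ℕ) (hu : N ≤ u)
    (hb : W.b (u + 1) = 0) (hne : W.j (u + 1) ≠ W.j u) (hzero : (W.st (u + 1)).r (W.j (u + 1)) = 0) :
    False := by
  obtain ⟨m, hmn, hmc⟩ := exists_third hne.symm
  obtain ⟨o₀, ho₀, hq0, -, hod0⟩ := h.order hroot u hu
  obtain ⟨o₁, ho₁, hq1, -, hod1⟩ := h.order hroot (u + 1) (by omega)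
  obtain ⟨o₂, ho₂, hq2, -, hod2⟩ := h.order hroot (u + 2) (by omega)
  obtain ⟨hd1, -, hkeep1⟩ := h.step hroot (u + 1) (by omega)
  rw [show u + 1 + 1 = u + 2 from rfl] at hd1 hkeep1
  have hkept1 := kept_degree_of_untranslated W (u + 1) hb
  have hD1 : (W.st (u + 1)).r.degree = (W.st (u + 1)).r (W.j u) + (W.st (u + 1)).r m := by
    rw [degree_eq_three (W.st (u + 1)).r hne.symm hmn hmc]
    omega
  have hw2 := h.degree_window hroot (u + 2) (by omega)
  have hS : StaysOnNewest W u := ⟨hne, by rw [hb]; rfl⟩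
  have hJ := corner_bound_of_untranslated_repeat hroot W u ho₀ ho₁ hq0 hq1 (h.plat u hu) (h.plat (u + 1) (by omega))
    (h.shade_eq u hu) (by norm_num) hS hb hmc hmn
  have hT : TightRepeat W u m :=
    { plat₀ := h.plat u hu
      plat₁ := h.plat (u + 1) (by omega)
      plat₂ := h.plat (u + 2) (by omega)
      three := h.shade_eq u hu
      ex₀ := by rw [ho₀]; exact_mod_cast hq0
      ex₁ := by rw [ho₁]; exact_mod_cast hq1
      ex₂ := by rw [ho₂]; exact_mod_cast hq2
      ne := hne
      untrans := hb
      ki := hmc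
      kj := hmn
      tight := by omega }
  obtain ⟨hl2, hbn, hbm⟩ := hT.escape hroot
  obtain ⟨hd2, -, -⟩ := h.step hroot (u + 2) (by omega)
  rw [show u + 2 + 1 = u + 3 from rfl] at hd2
  have hk0 : (kept W (u + 2)).degree = 0 := by
    have hkn : kept W (u + 2) (W.j u) = 0 := by
      rw [kept_apply, if_neg]
      exact fun h' => hbn h'.2
    have hkm : kept W (u + 2) m = 0 := by
      rw [kept_apply, if_neg]
      exact fun h' => hbm h'.2
    have hkc : kept W (u + 2) (W.j (u + 1)) = 0 := by rw [← hl2]; exact kept_chart W (u + 2)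
    rw [degree_eq_three (kept W (u + 2)) hne.symm hmn hmc]
    omega
  have hw3 := h.degree_window hroot (u + 3) (by omega)
  omega

/-- **(P3) POVERTY PROPAGATES** along the tail. [new] [folklore] -/
theorem hasZero_succ (hroot : IsRoot q s₀) (hq : 7 ≤ q) (h : TailThree W N) (u : ℕ) (hu : N ≤ u)
    (hz : HasZero W (u + 1)) : HasZero W (u + 2) := by
  obtain ⟨l, hl⟩ := hz
  obtain ⟨o₁, ho₁, hq1, -, -⟩ := h.order hroot (u + 1) (by omega)
  by_cases hb : W.b (u + 1) = 0
  · by_cases hc : W.j (u + 1) = l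
    · exfalso
      obtain ⟨o₀, -, hq0, -, hod0⟩ := h.order hroot u hu
      obtain ⟨-, hn, -⟩ := h.step hroot u hu
      refine h.repeat_into_zero_false hroot hq u hu hb (fun heq => ?_) (by rw [hc]; exact hl)
      rw [← heq, hc] at hn
      omega
    · obtain ⟨-, -, hkeep⟩ := h.step hroot (u + 1) (by omega)
      refine ⟨l, ?_⟩
      rw [hkeep l (fun h' => hc h'.symm), kept_apply]
      split_ifs
      · exact hl
      · rfl
  · exact hasZero_of_translated W (u + 1) ho₁ hb

/-- **(P4) TWO CONSECUTIVE POOR STAGES ADMIT NO PROXIMITY REPEAT** (`q ≥ 7`). [new] [folklore] -/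
theorem repeat_false (hroot : IsRoot q s₀) (hq : 7 ≤ q) (h : TailThree W N) (u : ℕ) (hu : N ≤ u)
    (hz0 : HasZero W u) (hz1 : HasZero W (u + 1)) (hS : StaysOnNewest W u) : False := by
  obtain ⟨hne, hbn⟩ := hS
  obtain ⟨m, hmn, hmc⟩ := exists_third hne.symm
  have hD0 := degree_lt_of_hasZero hroot W u hz0
  have hD1 := degree_lt_of_hasZero hroot W (u + 1) hz1
  obtain ⟨-, hn, -⟩ := h.step hroot u hu
  obtain ⟨hd1, -, -⟩ := h.step hroot (u + 1) (by omega)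
  rw [show u + 1 + 1 = u + 2 from rfl] at hd1
  have hw0 := h.degree_window hroot u hu
  have hw2 := h.degree_window hroot (u + 2) (by omega)
  obtain ⟨hk, hkm⟩ := kept_three W u hne hmn hmc hbn
  have hdeg1 : (W.st (u + 1)).r.degree = (W.st (u + 1)).r (W.j u) + (W.st (u + 1)).r (W.j (u + 1)) +
      (W.st (u + 1)).r m := degree_eq_three (W.st (u + 1)).r hne.symm hmn hmc
  by_cases hbm : W.b (u + 1) m = 0
  · rw [if_pos hbm] at hkm
    have hb0 : W.b (u + 1) = 0 := by
      funext x
      rcases fin3_cases hne.symm hmn hmc x with hx | hx | hx <;> rw [hx]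
      · exact hbn
      · exact W.onExc (u + 1)
      · exact hbm
    obtain ⟨l, hl⟩ := hz1
    rcases fin3_cases hne.symm hmn hmc l with hx | hx | hx <;> rw [hx] at hl
    · omega
    · exact h.repeat_into_zero_false hroot hq u hu hb0 hne hl
    · omega
  · rw [if_neg hbm] at hkm
    omega

/-- **THE SHADE-THREE WINDOW IS EMPTY** (`q ≥ 7`; new, g17).  A shade-3 tail with positive excess, proximity
repeats i.o. and translations i.o. does not exist: after the first translation every later stage is POOR (P2,
P3), and two consecutive poor stages admit no proximity repeat (P4). [folklore] -/
theorem shadeThree_tail_false (hroot : IsRoot q s₀) (hq : 7 ≤ q) {W : ForcedWalk q s₀} {N : ℕ}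
    (h : TailThree W N) (hrep : ∀ M, ∃ t, M ≤ t ∧ StaysOnNewest W t) (htr : ∀ M, ∃ t, M ≤ t ∧ W.b t ≠ 0) :
    False := by
  obtain ⟨t₁, ht₁, hb⟩ := htr N
  obtain ⟨o, ho, -⟩ := h.order hroot t₁ ht₁
  have hz : HasZero W (t₁ + 1) := hasZero_of_translated W t₁ ho hb
  have hall : ∀ d, HasZero W (t₁ + d + 1) := by
    intro d
    induction d with
    | zero => exact hz
    | succ d ih =>
      rw [show t₁ + (d + 1) + 1 = t₁ + d + 2 by omega]
      exact h.hasZero_succ hroot hq (t₁ + d) (by omega) ih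
  obtain ⟨u, hu, hS⟩ := hrep (t₁ + 1)
  have hz0 : HasZero W u := by
    have := hall (u - t₁ - 1)
    rwa [show t₁ + (u - t₁ - 1) + 1 = u by omega] at this
  have hz1 : HasZero W (u + 1) := by
    have := hall (u - t₁)
    rwa [show t₁ + (u - t₁) + 1 = u + 1 by omega] at this
  exact h.repeat_false hroot hq u (by omega) hz0 hz1 hS

end TailThree

end Poverty

end Summit.ResolutionOfSingularities.ResolutionOfSingularities.Theorems.TightCut
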